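import Summits.NavierStokesRegularity.NavierStokesRegularity.Theorems.OddMorawetzLocal.Negative.OddMorawetzLocalRefutationData5
import Summits.NavierStokesRegularity.NavierStokesRegularity.Theorems.OddMorawetzLocal.Negative.OddMorawetzLocalRefutationDefsV
import HarnessLib

/-!
# Crux `OddMorawetzLocal` (stmt-NavierStokesRegularity-1376) — kernel certificates, weight 5 (part D1)

The finite computations of the weight-5 half of the refutation, each a closed Boolean evaluated by the kernel
(`decide +kernel`) on the vocabulary of `OddMorawetzLocalJetAlgebra` / `…RefutationDefs{,Fast,IV,V}` and the literal
data of `…RefutationData5`.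
Parts D1–D3: `cert5_iso_recon_*` — every isotropic basis polynomial is the combination of normalised orbit sums given by
its orbit coordinates.
Chunks of two descriptors per theorem (kernel memory). No analysis; lands `--supports` the crux item.
-/

set_option linter.dupNamespace false

namespace Summit.NavierStokesRegularity.NavierStokesRegularity.Theorems.OddMorawetz

/-- Isotropic basis elements `0`, `1`: reconstructed from their orbit coordinates. -/
theorem cert5_iso_recon_0 : (((isoDesc5.drop 0).take 2).all fun d => orbitReconF reps5 (isoPolyF d)) = true := by
  decide +kernel

/-- Isotropic basis elements `2`, `3`: reconstructed from their orbit coordinates. -/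
theorem cert5_iso_recon_1 : (((isoDesc5.drop 2).take 2).all fun d => orbitReconF reps5 (isoPolyF d)) = true := by
  decide +kernel

/-- Isotropic basis elements `4`, `5`: reconstructed from their orbit coordinates. -/
theorem cert5_iso_recon_2 : (((isoDesc5.drop 4).take 2).all fun d => orbitReconF reps5 (isoPolyF d)) = true := by
  decide +kernel

/-- Isotropic basis elements `6`, `7`: reconstructed from their orbit coordinates. -/
theorem cert5_iso_recon_3 : (((isoDesc5.drop 6).take 2).all fun d => orbitReconF reps5 (isoPolyF d)) = true := by
  decide +kernel

/-- Isotropic basis elements `8`, `9`: reconstructed from their orbit coordinates. -/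
theorem cert5_iso_recon_4 : (((isoDesc5.drop 8).take 2).all fun d => orbitReconF reps5 (isoPolyF d)) = true := by
  decide +kernel

/-- Isotropic basis elements `10`, `11`: reconstructed from their orbit coordinates. -/
theorem cert5_iso_recon_5 : (((isoDesc5.drop 10).take 2).all fun d => orbitReconF reps5 (isoPolyF d)) = true := by
  decide +kernel

/-- Isotropic basis elements `12`, `13`: reconstructed from their orbit coordinates. -/
theorem cert5_iso_recon_6 : (((isoDesc5.drop 12).take 2).all fun d => orbitReconF reps5 (isoPolyF d)) = true := by
  decide +kernel

/-- Isotropic basis elements `14`, `15`: reconstructed from their orbit coordinates. -/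
theorem cert5_iso_recon_7 : (((isoDesc5.drop 14).take 2).all fun d => orbitReconF reps5 (isoPolyF d)) = true := by
  decide +kernel

/-- Isotropic basis elements `16`, `17`: reconstructed from their orbit coordinates. -/
theorem cert5_iso_recon_8 : (((isoDesc5.drop 16).take 2).all fun d => orbitReconF reps5 (isoPolyF d)) = true := by
  decide +kernel

end Summit.NavierStokesRegularity.NavierStokesRegularity.Theorems.OddMorawetz
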